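import Summits.BirchSwinnertonDyer.BirchSwinnertonDyer.Theorems.GenusKolyvaginAtTwoMinimalTwinBSDTwoEggSplit
import Summits.BirchSwinnertonDyer.BirchSwinnertonDyer.Theorems.GenusKolyvaginAtTwoMinimalTwinBSDTwoSwappedPairBudgetParity
import HarnessLib

/-!
# Route `GenusKolyvaginAtTwo`, crux U₂ `MinimalTwinBSDTwo` (stmt-BirchSwinnertonDyer-22985): ON THE ε = −1 SUB-CELL `hTw0^{id}` EVERY
# `2`-SELMER-TRIVIAL REVERSED HEEGNER TWIN IS AT TAMAGAWA DEFECT ≥ 2 — the residual of LINE 23 lives in the two-bit (K₄⁺ / X⁼²) regime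

Seat `bsd-line-gk2-p3` g28 (PROVER seat 3/3, cell `bsd-f1-sign2`), `--supports stmt-BirchSwinnertonDyer-22985` (helper; closes nothing).
THEOREMS ONLY (no definition, no named fact, no `sorry`); standard axioms; UNCONDITIONAL.  **BSD is NOT proved by this file; nothing is
closed.**

For `W/ℚ` globally minimal with `Δ_W > 0`, `ρ̄_{W,2}` onto, rank `1`, `#Sel₂(W) = 2` and `W(ℚ) ⊂ W⁰(ℝ)` (¬`MeetsEgg`), and ANY imaginary
quadratic `K` with `d_K` odd, Heegner for `N_W`, and any elliptic model `Wd` of `W^(d_K)`: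
* the twist is NOT silent if `#Sel₂(Wd) = 1` (`Egg.natCard_selmerGroup_twin_of_silent`, p769884: a silent twin has `#Sel₂ = 4`);
* the bit count `ord₂ C(Wd) − ord₂ C(W)` is `≥ 0` (hT-free budget `OneBit.prod_ncard_roots_add_one_mul_eq_two_pow_…`, p766610) and EVEN
  (`BudgetParity.even_padicValNat_add_of_Δ_pos`, p767705);
hence **`#Sel₂(Wd) = 1 ⟹ ord₂ C(Wd) ≥ ord₂ C(W) + 2`** (§1 `padicValNat_add_two_le_of_selmerTrivial_twin_of_not_meetsEgg`).  READING: a reversed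
`2`-Selmer-trivial Heegner twin serving U₂ on `hTw0^{id}` carries at least TWO Tamagawa bits (two transposition primes or one identity prime) —
the swapped sandwich there has the defect-`2` budget of this seat's `…DefectSizing` (p766973) / gk2-p4 g27's one-bit law, i.e. `hTw0^{id}` is
EXACTLY the U₂-side of the K₄⁺ / X⁼² cells and of the sibling line's «two finite doors» (T-2q / AN-26); no cheaper reversed supply exists.
Also §0 `padicValNat_le_padicValNat_twin` (any sign, any `C(W)`: `ord₂ C(W) ≤ ord₂ C(Wd)`, unconditional).

References: [Kramer1981] §2 Props. 3, 6, Thm. 1; [MazurRubin2010] Cor. 3.4 (i); [SilvermanAEC2009] VII.6; [Miller2011LMS] Def. 1.1.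
-/

set_option autoImplicit false
set_option linter.dupNamespace false -- `Summit.<P>.<Sub>` repeats `BirchSwinnertonDyer` (D-0017)

noncomputable section

open scoped Classical

open WeierstrassCurve NumberField Literature.NumberTheory.EllipticCurves
  Summit.BirchSwinnertonDyer.Rank1Residual.F1Sign2
  Summit.BirchSwinnertonDyer.BirchSwinnertonDyer.Theorems.GenusExact.TwinSwap.OneBit
  Summit.BirchSwinnertonDyer.BirchSwinnertonDyer.Theorems.GenusExact.PlusDescent.BudgetParity

namespace Summit.BirchSwinnertonDyer.BirchSwinnertonDyer.Theorems.GenusExact.TwinSwap.Egg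

variable (W : WeierstrassCurve ℚ) [W.IsElliptic] [W.IsGloballyMinimal] {K : Type} [Field K] [NumberField K]

/-! ## §0 The bit count is non-negative -/

/-- **`ord₂ C(W) ≤ ord₂ C(Wd)`** for every odd Heegner twist of a globally minimal curve (any sign of `Δ`, any `C(W)`): the hT-free budget
`(∏_q (n_q + 1)) · 2^{ord₂ C(W)} = 2^{ord₂ C(Wd)}`.  UNCONDITIONAL.  [cite: Kramer1981, §2 Prop. 3] [cite: SilvermanAEC2009, VII.6] -/
theorem padicValNat_le_padicValNat_twin (hK : IsImaginaryQuadratic K) (hodd : Odd (discr K))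
    (hH : SatisfiesHeegnerHypothesis (W.conductorNorm ℤ) K)
    {Wd : WeierstrassCurve ℚ} [Wd.IsElliptic] (Cd : VariableChange ℚ) (hWd : Cd • W.quadraticTwist (discr K : ℚ) = Wd) :
    padicValNat 2 W.tamagawaProduct ≤ padicValNat 2 Wd.tamagawaProduct := by
  have h := prod_ncard_roots_add_one_mul_eq_two_pow_padicValNat_tamagawaProduct_twin W hK hodd hH Cd hWd
  have hdvd : 2 ^ padicValNat 2 W.tamagawaProduct ∣ 2 ^ padicValNat 2 Wd.tamagawaProduct := Dvd.intro_left _ h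
  exact (Nat.pow_dvd_pow_iff_le_right Nat.one_lt_two).mp hdvd

/-! ## §1 On `hTw0^{id}` a Selmer-trivial reversed twin has at least two Tamagawa bits -/

/-- **`#Sel₂(Wd) = 1 ⟹ ord₂ C(Wd) ≥ ord₂ C(W) + 2` on the ε = −1 sub-cell.**  `W/ℚ` globally minimal, `Δ_W > 0`, `ρ̄_{W,2}` onto, rank `1`,
`#Sel₂(W) = 2`, `W(ℚ) ⊂ W⁰(ℝ)`; `K` imaginary quadratic, `d_K` odd, Heegner for `N_W`; `Wd = Cd • W^(d_K)` elliptic with `#Sel₂(Wd) = 1`.  Then the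
twist is not silent (Egg Split), the bit count is even (parity law) and non-negative (§0): at least TWO bits.  UNCONDITIONAL.
[cite: Kramer1981, §2 Props. 3, 6] [cite: MazurRubin2010, Cor. 3.4 (i)] -/
theorem padicValNat_add_two_le_of_selmerTrivial_twin_of_not_meetsEgg (hK : IsImaginaryQuadratic K) (hodd : Odd (discr K))
    (hH : SatisfiesHeegnerHypothesis (W.conductorNorm ℤ) K)
    (hΔ : 0 < W.Δ) (hsurj : W.HasSurjectiveModNGaloisRep 2) (hrk : W.mordellWeilRank = 1) (hSel : Nat.card (W.selmerGroup 2) = 2)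
    (hegg : ¬ MeetsEgg W)
    {Wd : WeierstrassCurve ℚ} [Wd.IsElliptic] (Cd : VariableChange ℚ) (hWd : Cd • W.quadraticTwist (discr K : ℚ) = Wd)
    (hSel1 : Nat.card (Wd.selmerGroup 2) = 1) :
    padicValNat 2 W.tamagawaProduct + 2 ≤ padicValNat 2 Wd.tamagawaProduct := by
  have hle := padicValNat_le_padicValNat_twin W hK hodd hH Cd hWd
  obtain ⟨k, hk⟩ := even_padicValNat_add_of_Δ_pos W hK hodd hH hΔ Cd hWd
  have hne : padicValNat 2 Wd.tamagawaProduct ≠ padicValNat 2 W.tamagawaProduct := by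
    intro hSil
    have h4 := (natCard_selmerGroup_twin_of_silent W hK hodd hH hΔ hsurj hrk hSel Cd hWd hSil).2 hegg
    omega
  omega

/-- **Contrapositive, supply currency**: on the ε = −1 sub-cell NO reversed Heegner twin at Tamagawa defect `≤ 1` is `2`-Selmer-trivial —
in particular none with `ord₂ C(Wd) = 0` (LINE 23's all-silent S2″) and none at one bit.  UNCONDITIONAL.
[cite: Kramer1981, §2 Props. 3, 6] [cite: MazurRubin2010, Cor. 3.4 (i)] -/
theorem natCard_selmerGroup_twin_ne_one_of_le_succ_of_not_meetsEgg (hK : IsImaginaryQuadratic K) (hodd : Odd (discr K))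
    (hH : SatisfiesHeegnerHypothesis (W.conductorNorm ℤ) K)
    (hΔ : 0 < W.Δ) (hsurj : W.HasSurjectiveModNGaloisRep 2) (hrk : W.mordellWeilRank = 1) (hSel : Nat.card (W.selmerGroup 2) = 2)
    (hegg : ¬ MeetsEgg W)
    {Wd : WeierstrassCurve ℚ} [Wd.IsElliptic] (Cd : VariableChange ℚ) (hWd : Cd • W.quadraticTwist (discr K : ℚ) = Wd)
    (hDEF : padicValNat 2 Wd.tamagawaProduct ≤ padicValNat 2 W.tamagawaProduct + 1) :
    Nat.card (Wd.selmerGroup 2) ≠ 1 := by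
  intro hSel1
  have h := padicValNat_add_two_le_of_selmerTrivial_twin_of_not_meetsEgg W hK hodd hH hΔ hsurj hrk hSel hegg Cd hWd hSel1
  omega

end Summit.BirchSwinnertonDyer.BirchSwinnertonDyer.Theorems.GenusExact.TwinSwap.Egg

end
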